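import Literature.MathematicalPhysics.QuantumFieldTheory.Balaban1983to89.B5Pieces133Torus

/-!
# `Balaban1983to89.B5CombesThomasTorus` — the «simplest proof» route of B5 p. 36 for G₀ = (Δ + aQ*Q)⁻¹ ON THE TORUS:
# exponentially conjugated quadratic form of `M0 = −Δ^η + (Lᵏε)²m² + aQ*_μQ_μ`, its coercivity from (1.90), and the
# weighted solves `‖e^{δρ}G₀g‖, ‖∂(e^{δρ}G₀g)‖ ≤ (2/γ₀)‖e^{δρ}g‖`

statement-level skeleton of published theorems with citation tags; proofs where landed; nothing here is a claim
about the Yang–Mills mass gap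

Source (lit-balaban cell, Phase-2 proof seat p38 gen 5): T. Bałaban, *Propagators and renormalization transformations
for lattice gauge theories. I*, Commun. Math. Phys. **95** (1984) 17–40 [`Balaban1984PropagatorsI`, "B5"], p. 36
[PDF 20] and p. 33 [PDF 17]; held as `paper:balaban1984-cmp95-propagators-rt-i` (OCR pages p0020/p0017 read this session).

## WHAT IS PRINTED (verbatim)

p. 36 [PDF 20], after (1.117): «A proof of Proposition 1.2 will be given in several steps. In the first step we will
show that the inequalities (1.115)-(1.117), (1.89) imply the proposition. Probably the simplest proof of the exponential
decay properties can be obtained by relating G on the torus to G on the whole lattice ηZ^d in the usual way, and then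
proving that the operator e^{−⟨q,x⟩}Δ_a e^{⟨q,x⟩} − Δ_a is a small perturbation of Δ_a for vectors q ∈ R^d sufficiently
small. Instead we construct a random walk representation of the kind described in [2].»
p. 33 [PDF 17], Prop. 1.1: «… (1.89) with a positive constant γ₀ independent of k, T_η, and depending on d only (if we put
a = 1). This implies the bound from below: Δ_a = G⁻¹ ≥ γ₀(Δ + I). (1.90)»
p. 39 [PDF 23]: «where G₀ = (Δ + aQ*Q)⁻¹. … We only have to know some weak bounds for G₀, for example bounds in the
L²-norm (1.89), or (1.114). … we have Proposition 1.1 for G₀.»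

## WHAT THIS MODULE PROVES (kernel-checked, zero sorry) — the analytic core of the p. 36 route, run ON THE TORUS

The printed suggestion conjugates Δ_a by the exponential of a LINEAR function after lifting to ηℤ^d.  We stay on the
torus T_η = `Site P 0` (level k, η = L^{−k}) and conjugate the scalar operator `M0 P a m² k μ` = G₀^{(μ)−1} of
`B5Eq133G0Torus` by the multiplication operator e^{δρ} for an ARBITRARY function ρ that is 1-Lipschitz for the scaled sup
distance `distX P k` (e.g. ρ = distX(·, x₀), the instance used by `B5Local114G0First`).  Everything is real and M0 is a
symmetric matrix, so only the symmetric part of the conjugated operator enters the quadratic form — the first-order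
terms cancel identically and the perturbation is O(δ²) (the «small perturbation of Δ_a … for q sufficiently small»):
§1 elementary: `e^σ + e^{−σ} − 2 ≤ 2σ²` and `|e^σ − 1| ≤ 2|σ|` (|σ| ≤ 1); η = ε/(Lᵏε) = L^{−k} ∈ (0, 1].
§2 the weight `wt δ ρ x = exp(δρ x)`; one fine step changes ρ by ≤ η, two points on the support of Q_μ(y, ·) differ in ρ
   by ≤ 4 (`abs_sub_le_four_of_Qv`).
§3 CONJUGATED LAPLACIAN: the pointwise identity `∂(wu)·∂(w⁻¹u) = (∂u)² − η⁻²(t + t⁻¹ − 2)u·u⁺` (t = w⁺/w) and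
   `(wu)·(−Δ^η + m̃²)(w⁻¹u) ≥ u·(−Δ^η + m̃²)u − 2dδ²Σu²` (`conjLap_ge`).
§4 CONJUGATED AVERAGING: `(wu)·Q*_μQ_μ(w⁻¹u) ≥ u·Q*_μQ_μu − 16δ²Σu²` (`conjQ_ge`; Schur bound `Σ_y(Q_μf)(y)² ≤ η^dΣf²`).
§5 COERCIVITY AND THE SOLVES: under (1.90) in the form `γ₀·u·(−Δ^η + 1)u ≤ u·M0u` and (2d + 16a)δ² ≤ γ₀/2, for every
   source g and v = G₀g, u = e^{δρ}v:  `Σ_μ‖∂_μu‖² + ‖u‖² ≤ (2/γ₀)²‖e^{δρ}g‖²` (`solve_bound`), the same with (4/γ₀)² for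
   v = G₀∂*_νg (`solveT_bound`), the cap-free mass bound `(Lᵏε)²m²‖u‖ ≤ 2‖e^{δρ}g‖` (`mass_bound`), and the pointwise
   product rule `|∂(e^{δρ}u)| ≤ e^{δρ}((3/2)|∂u| + 2δ|u|)` (`abs_deriv_pmul_le`).
All sums are the unweighted Σ_x (the common weight η^d of L²(T_η) is restored by the consumer).

## HONEST SCOPE / DIVERGENCE

This is NOT the random-walk expansion (1.118)–(1.131) that the paper carries out («Instead we construct …»); it is the
alternative the same paragraph names, adapted to the torus (Lipschitz weight e^{δρ} in place of e^{⟨q,x⟩} on ηZ^d — a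
DIVERGENCE of method, disclosed; the statements it serves, (1.114) for G₀, are unchanged and typed elsewhere verbatim:
`B5.Local114Fam`).  Inputs: (1.90) as the HYPOTHESIS `hco : ∀ f, γ₀·f·(Δ + 1)f ≤ f·M0 f` (unweighted; it is clause 2 of
`B5.Prop11Printed` for the G₀-settings, discharged by the consumer), `0 < a`, `0 ≤ m²`, `k ≤ m + K` (Bałaban's levels).
Nothing about G (the operator with ∂P∂*) here.
CELL BOOK-KEEPING (lit-balaban): row B5.Prop1.2, census item (vi) «h114G0» (owner r02, referee ref-4); VALUE = the L²
decay mechanism for Bałaban's concrete G₀ on the torus, kernel-checked — NOT summit progress.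
-/

namespace Literature.MathematicalPhysics.QuantumFieldTheory.Balaban1983to89

open Matrix Finset

noncomputable section

namespace B5CombesThomasTorus

open B1RG242Torus B5Ineq137Torus B5GpSettingTorus B5Eq133G0Torus B5G0SettingTorus B5Pieces133Torus

variable {P : Params}

/-! ## §1 Elementary facts: η = L^{−k}, exponential bounds -/

/-- η = ε/(Lᵏε) = L^{−k} (the deriv scale of `dEta`/`lapEta`/`M0`). [cite: Balaban1984PropagatorsI, p.35 (η = L^{−k})] -/
theorem eps_div_spacing (k : ℕ) : P.eps / P.spacing k = ((P.L : ℝ) ^ k)⁻¹ := by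
  rw [Params.spacing]
  have h := P.eps_pos
  field_simp

/-- η > 0. [cite: Balaban1984PropagatorsI, p.35 (T_η, η = L^{−k}; the cubes Δ̃(y))] -/
theorem eta_pos (k : ℕ) : 0 < ((P.L : ℝ) ^ k)⁻¹ := inv_pos.mpr (pow_pos P.cast_L_pos k)

/-- Lᵏ ≥ 1. [cite: Balaban1984PropagatorsI, p.35 (T_η, η = L^{−k}; the cubes Δ̃(y))] -/
theorem one_le_Lpow (k : ℕ) : (1 : ℝ) ≤ (P.L : ℝ) ^ k :=
  one_le_pow₀ (by exact_mod_cast P.L_pos : (1 : ℝ) ≤ P.L)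

/-- η ≤ 1. [cite: Balaban1984PropagatorsI, p.35 (T_η, η = L^{−k}; the cubes Δ̃(y))] -/
theorem eta_le_one (k : ℕ) : ((P.L : ℝ) ^ k)⁻¹ ≤ 1 := inv_le_one_of_one_le₀ (one_le_Lpow k)

/-- `e^σ + e^{−σ} − 2 ≤ 2σ²` for `|σ| ≤ 1` (from `|e^x − 1 − x| ≤ x²`). [folklore] -/
private theorem exp_add_exp_neg_sub_two_le {σ : ℝ} (h : |σ| ≤ 1) : Real.exp σ + Real.exp (-σ) - 2 ≤ 2 * σ ^ 2 := by
  have h1 := Real.abs_exp_sub_one_sub_id_le h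
  have h2 := Real.abs_exp_sub_one_sub_id_le (show |(-σ)| ≤ 1 by rwa [abs_neg])
  have e1 := (abs_le.mp h1).2
  have e2 := (abs_le.mp h2).2
  nlinarith

/-- `0 ≤ e^σ + e^{−σ} − 2` (AM–GM). [folklore] -/
private theorem exp_add_exp_neg_sub_two_nonneg (σ : ℝ) : 0 ≤ Real.exp σ + Real.exp (-σ) - 2 := by
  have hp := Real.exp_pos σ
  have hprod : Real.exp σ * Real.exp (-σ) = 1 := by rw [← Real.exp_add, add_neg_cancel, Real.exp_zero]
  nlinarith [sq_nonneg (Real.exp σ - Real.exp (-σ)), Real.exp_pos (-σ)]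

/-- `t + t⁻¹ − 2 ≤ 2σ²` for `t = e^σ`, `|σ| ≤ 1`. [folklore] -/
private theorem ratio_add_inv_sub_two_le {σ : ℝ} (h : |σ| ≤ 1) :
    Real.exp σ + (Real.exp σ)⁻¹ - 2 ≤ 2 * σ ^ 2 := by
  rw [← Real.exp_neg]; exact exp_add_exp_neg_sub_two_le h

/-- `0 ≤ t + t⁻¹ − 2` for `t = e^σ`. [folklore] -/
private theorem ratio_add_inv_sub_two_nonneg (σ : ℝ) : 0 ≤ Real.exp σ + (Real.exp σ)⁻¹ - 2 := by
  rw [← Real.exp_neg]; exact exp_add_exp_neg_sub_two_nonneg σ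

/-! ## §2 The weight e^{δρ} for a `distX`-Lipschitz ρ -/

/-- **ρ is 1-Lipschitz for the scaled sup distance `distX P k`** (η-units): the class of exponents of the conjugation
(ρ = distX(·, x₀) and −distX(·, x₀) are the instances used downstream). [cite: Balaban1984PropagatorsI, p.36 («e^{−⟨q,x⟩}Δ_a e^{⟨q,x⟩}»)] -/
def LipX (P : Params) (k : ℕ) (ρ : Site P 0 → ℝ) : Prop := ∀ x x' : Site P 0, |ρ x - ρ x'| ≤ distX P k x x'

/-- `distX(·, x₀)` is 1-Lipschitz (triangle inequality). [cite: Balaban1984PropagatorsI, p.36 («e^{−⟨q,x⟩}Δ_a e^{⟨q,x⟩} − Δ_a … small perturbation of Δ_a»)] -/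
theorem lipX_distX (k : ℕ) (x₀ : Site P 0) : LipX P k (fun x => distX P k x x₀) := by
  intro x x'
  have hL : (0 : ℝ) ≤ ((P.L : ℝ) ^ k)⁻¹ := (eta_pos k).le
  unfold distX
  rw [← mul_sub, abs_mul, abs_of_nonneg hL]
  refine mul_le_mul_of_nonneg_left (abs_sub_le_iff.mpr ⟨?_, ?_⟩) hL
  · have := T_triangle P 0 x x' x₀; linarith
  · have := T_triangle P 0 x' x x₀; rw [T_symm P 0 x' x] at this; linarith

/-- `−ρ` is Lipschitz when ρ is. [cite: Balaban1984PropagatorsI, p.36 («e^{−⟨q,x⟩}Δ_a e^{⟨q,x⟩} − Δ_a … small perturbation of Δ_a»)] -/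
theorem LipX.neg {k : ℕ} {ρ : Site P 0 → ℝ} (h : LipX P k ρ) : LipX P k (fun x => -ρ x) := by
  intro x x'
  rw [show -ρ x - -ρ x' = -(ρ x - ρ x') by ring, abs_neg]
  exact h x x'

/-- One fine step has `distX`-length η = L^{−k}. [cite: Balaban1984PropagatorsI, p.35 (T_η, η = L^{−k}; the cubes Δ̃(y))] -/
theorem distX_shift_le (k : ℕ) (x : Site P 0) (μ : Fin P.d) :
    distX P k x (Site.shift x μ) ≤ ((P.L : ℝ) ^ k)⁻¹ := by
  unfold distX
  have h := T_shift_le_one 0 x μ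
  have hL := (eta_pos (P := P) k).le
  calc ((P.L : ℝ) ^ k)⁻¹ * T P 0 x (Site.shift x μ) ≤ ((P.L : ℝ) ^ k)⁻¹ * 1 :=
        mul_le_mul_of_nonneg_left h hL
    _ = ((P.L : ℝ) ^ k)⁻¹ := mul_one _

/-- Along one fine step a Lipschitz ρ changes by at most η. [cite: Balaban1984PropagatorsI, p.36 («e^{−⟨q,x⟩}Δ_a e^{⟨q,x⟩} − Δ_a … small perturbation of Δ_a»)] -/
theorem LipX.shift {k : ℕ} {ρ : Site P 0 → ℝ} (h : LipX P k ρ) (x : Site P 0) (μ : Fin P.d) :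
    |ρ (Site.shift x μ) - ρ x| ≤ ((P.L : ℝ) ^ k)⁻¹ :=
  (h _ _).trans (by rw [distX_comm]; exact distX_shift_le k x μ)

/-- A point on the support of `Q_μ(y, ·)` lies within `2L^k − 1` fine steps of the corner of B^k(y) (it is
`x′ + tηe_μ`, x′ ∈ B^k(y), t < L^k). [cite: Balaban1984PropagatorsI, (1.18) p.20] -/
theorem T_fine_le_of_Qv {k : ℕ} (hk : k ≤ P.m + P.K) {μ : Fin P.d} {y : Site P k} {x : Site P 0}
    (h : Qv P k μ y x ≠ 0) : T P 0 x (fine P k y) ≤ 2 * (P.L : ℝ) ^ k - 1 := by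
  obtain ⟨x', hx', t, ht, rfl⟩ := Qv_apply_ne_zero hk h
  have h1 : T P 0 (shiftN P x' μ t) x' ≤ t := by rw [T_symm]; exact T_shiftN_le x' μ t
  have h2 : T P 0 x' (fine P k y) ≤ (P.L : ℝ) ^ k - 1 := by
    have := T_blk_le P hk x'
    rwa [← proj_eq_blk, hx'] at this
  have h3 := T_triangle P 0 (shiftN P x' μ t) x' (fine P k y)
  have ht' : (t : ℝ) ≤ (P.L : ℝ) ^ k := by
    have : (t : ℝ) < ((P.L ^ k : ℕ) : ℝ) := by exact_mod_cast ht
    push_cast at this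
    linarith
  linarith

/-- Two points on the support of `Q_μ(y, ·)` are less than 4 apart in η-units. [cite: Balaban1984PropagatorsI, (1.18) p.20] -/
theorem distX_lt_four_of_Qv {k : ℕ} (hk : k ≤ P.m + P.K) {μ : Fin P.d} {y : Site P k} {x x' : Site P 0}
    (h : Qv P k μ y x ≠ 0) (h' : Qv P k μ y x' ≠ 0) : distX P k x x' < 4 := by
  have hL : (0 : ℝ) < (P.L : ℝ) ^ k := pow_pos P.cast_L_pos k
  have h1 := T_fine_le_of_Qv hk h
  have h2 := T_fine_le_of_Qv hk h'
  have h3 := T_triangle P 0 x (fine P k y) x'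
  rw [T_symm P 0 (fine P k y) x'] at h3
  unfold distX
  rw [inv_mul_lt_iff₀ hL]
  linarith

/-- For a Lipschitz ρ: `|ρ x − ρ x′| ≤ 4` on the support of `Q_μ(y, ·)`. [cite: Balaban1984PropagatorsI, (1.18) p.20] -/
theorem LipX.abs_sub_le_four_of_Qv {k : ℕ} {ρ : Site P 0 → ℝ} (hρ : LipX P k ρ) (hk : k ≤ P.m + P.K)
    {μ : Fin P.d} {y : Site P k} {x x' : Site P 0} (h : Qv P k μ y x ≠ 0) (h' : Qv P k μ y x' ≠ 0) :
    |ρ x - ρ x'| ≤ 4 :=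
  (hρ x x').trans (distX_lt_four_of_Qv hk h h').le

variable (P) in
/-- **The weight e^{δρ}** of the conjugation. [cite: Balaban1984PropagatorsI, p.36 («e^{⟨q,x⟩}»)] -/
def wt (δ : ℝ) (ρ : Site P 0 → ℝ) (x : Site P 0) : ℝ := Real.exp (δ * ρ x)

/-- The weight is positive. [cite: Balaban1984PropagatorsI, p.36 («e^{−⟨q,x⟩}Δ_a e^{⟨q,x⟩} − Δ_a … small perturbation of Δ_a»)] -/
theorem wt_pos (δ : ℝ) (ρ : Site P 0 → ℝ) (x : Site P 0) : 0 < wt P δ ρ x := Real.exp_pos _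

/-- The weight is nonzero. [cite: Balaban1984PropagatorsI, p.36 («e^{−⟨q,x⟩}Δ_a e^{⟨q,x⟩} − Δ_a … small perturbation of Δ_a»)] -/
theorem wt_ne_zero (δ : ℝ) (ρ : Site P 0 → ℝ) (x : Site P 0) : wt P δ ρ x ≠ 0 := (wt_pos δ ρ x).ne'

/-- `w(x′)/w(x) = e^{δ(ρ x′ − ρ x)}`. [cite: Balaban1984PropagatorsI, p.36 («e^{−⟨q,x⟩}Δ_a e^{⟨q,x⟩} − Δ_a … small perturbation of Δ_a»)] -/
theorem wt_div (δ : ℝ) (ρ : Site P 0 → ℝ) (x x' : Site P 0) :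
    wt P δ ρ x' / wt P δ ρ x = Real.exp (δ * (ρ x' - ρ x)) := by
  rw [wt, wt, ← Real.exp_sub]; ring_nf

/-- The inverse weight is the weight of −ρ. [cite: Balaban1984PropagatorsI, p.36 («e^{−⟨q,x⟩}Δ_a e^{⟨q,x⟩} − Δ_a … small perturbation of Δ_a»)] -/
theorem wt_inv (δ : ℝ) (ρ : Site P 0 → ℝ) (x : Site P 0) : (wt P δ ρ x)⁻¹ = wt P δ (fun z => -ρ z) x := by
  rw [wt, wt, ← Real.exp_neg]; ring_nf

/-- Pointwise multiplication of a scalar function by a weight function. [folklore] -/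
def pmul (w f : Site P 0 → ℝ) : Site P 0 → ℝ := fun x => w x * f x

/-- unfolding of `pmul`. [cite: Balaban1984PropagatorsI, p.36 («e^{−⟨q,x⟩}Δ_a e^{⟨q,x⟩} − Δ_a … small perturbation of Δ_a»)] -/
@[simp] theorem pmul_apply (w f : Site P 0 → ℝ) (x : Site P 0) : pmul w f x = w x * f x := rfl

/-! ## §3 The conjugated Laplacian form -/

section Laplacian

variable {k : ℕ}

/-- the size of the conjugation ratio along one fine step: `|δ(ρ(x+ηe_μ) − ρ(x))| ≤ δη ≤ 1` for 0 ≤ δ ≤ 1.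
[folklore] -/
private theorem abs_delta_step_le {ρ : Site P 0 → ℝ} (hρ : LipX P k ρ) {δ : ℝ} (hδ0 : 0 ≤ δ) (hδ1 : δ ≤ 1)
    (x : Site P 0) (μ : Fin P.d) :
    |δ * (ρ (Site.shift x μ) - ρ x)| ≤ δ * ((P.L : ℝ) ^ k)⁻¹ ∧ δ * ((P.L : ℝ) ^ k)⁻¹ ≤ 1 := by
  refine ⟨?_, ?_⟩
  · rw [abs_mul, abs_of_nonneg hδ0]
    exact mul_le_mul_of_nonneg_left (hρ.shift x μ) hδ0
  · calc δ * ((P.L : ℝ) ^ k)⁻¹ ≤ 1 * 1 := mul_le_mul hδ1 (eta_le_one k) (eta_pos k).le zero_le_one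
      _ = 1 := one_mul _

/-- **The pointwise conjugation identity for the forward derivative**: with `t = w(x+ηe_μ)/w(x)`,
`∂^η_μ(wu)(x)·∂^η_μ(w⁻¹u)(x) = (∂^η_μu(x))² − η⁻²(t + t⁻¹ − 2)·u(x)u(x+ηe_μ)` — the antisymmetric (first-order) part
of `e^{δρ}(−Δ)e^{−δρ} − (−Δ)` drops out of the real quadratic form. [cite: Balaban1984PropagatorsI, p.36 («small perturbation of Δ_a»)] -/
theorem deriv_conj_pointwise {s : ℝ} (w u : Site P 0 → ℝ) (hw : ∀ z, w z ≠ 0) (μ : Fin P.d) (x : Site P 0) :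
    (deriv P 0 s μ *ᵥ pmul w u) x * (deriv P 0 s μ *ᵥ pmul (fun z => (w z)⁻¹) u) x
      = ((deriv P 0 s μ *ᵥ u) x) ^ 2
        - s⁻¹ ^ 2 * (w (Site.shift x μ) / w x + w x / w (Site.shift x μ) - 2)
          * (u x * u (Site.shift x μ)) := by
  simp only [deriv_mulVec, pmul_apply]
  have h1 := hw x
  have h2 := hw (Site.shift x μ)
  field_simp
  ring

/-- the perturbation coefficient is small: `0 ≤ η⁻²(t + t⁻¹ − 2) ≤ 2δ²` along a fine step, 0 ≤ δ ≤ 1.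
[cite: Balaban1984PropagatorsI, p.36 («for vectors q … sufficiently small»)] -/
private theorem step_coeff_bounds {ρ : Site P 0 → ℝ} (hρ : LipX P k ρ) {δ : ℝ} (hδ0 : 0 ≤ δ) (hδ1 : δ ≤ 1)
    (x : Site P 0) (μ : Fin P.d) :
    0 ≤ wt P δ ρ (Site.shift x μ) / wt P δ ρ x + wt P δ ρ x / wt P δ ρ (Site.shift x μ) - 2 ∧
      (((P.L : ℝ) ^ k)⁻¹)⁻¹ ^ 2 *
          (wt P δ ρ (Site.shift x μ) / wt P δ ρ x + wt P δ ρ x / wt P δ ρ (Site.shift x μ) - 2)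
        ≤ 2 * δ ^ 2 := by
  set σ := δ * (ρ (Site.shift x μ) - ρ x) with hσ
  have e1 : wt P δ ρ (Site.shift x μ) / wt P δ ρ x = Real.exp σ := wt_div δ ρ x _
  have e2 : wt P δ ρ x / wt P δ ρ (Site.shift x μ) = (Real.exp σ)⁻¹ := by
    rw [wt_div, ← Real.exp_neg, hσ]; ring_nf
  rw [e1, e2]
  obtain ⟨hσ1, hδη⟩ := abs_delta_step_le hρ hδ0 hδ1 x μ
  have hσle : |σ| ≤ 1 := hσ1.trans hδη
  refine ⟨ratio_add_inv_sub_two_nonneg σ, ?_⟩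
  have hb := ratio_add_inv_sub_two_le hσle
  have hL : (0 : ℝ) < (P.L : ℝ) ^ k := pow_pos P.cast_L_pos k
  rw [inv_inv]
  have hσsq : σ ^ 2 ≤ (δ * ((P.L : ℝ) ^ k)⁻¹) ^ 2 := by
    have := hσ1
    rw [← sq_abs σ]
    exact pow_le_pow_left₀ (abs_nonneg σ) hσ1 2
  calc ((P.L : ℝ) ^ k) ^ 2 * (Real.exp σ + (Real.exp σ)⁻¹ - 2)
      ≤ ((P.L : ℝ) ^ k) ^ 2 * (2 * (δ * ((P.L : ℝ) ^ k)⁻¹) ^ 2) :=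
        mul_le_mul_of_nonneg_left (hb.trans (by linarith)) (by positivity)
    _ = 2 * δ ^ 2 := by field_simp

/-- sums over the torus are invariant under one fine shift. [cite: Balaban1984PropagatorsI, (1.18) p.20] -/
theorem sum_shift (μ : Fin P.d) (f : Site P 0 → ℝ) : ∑ x, f (Site.shift x μ) = ∑ x, f x := by
  have h := sum_shiftN (P := P) (i := 0) μ 1 f
  simpa only [shiftN_succ, shiftN_zero] using h

/-- `Σ_x |u(x)||u(x+ηe_μ)| ≤ Σ_x u(x)²` (AM–GM and shift invariance). [cite: Balaban1984PropagatorsI, p.36 («e^{−⟨q,x⟩}Δ_a e^{⟨q,x⟩} − Δ_a … small perturbation of Δ_a»)] -/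
theorem sum_abs_mul_shift_le (μ : Fin P.d) (u : Site P 0 → ℝ) :
    ∑ x, |u x| * |u (Site.shift x μ)| ≤ ∑ x, u x ^ 2 := by
  have h1 : ∀ x, |u x| * |u (Site.shift x μ)| ≤ (u x ^ 2 + u (Site.shift x μ) ^ 2) / 2 := by
    intro x
    have := two_mul_le_add_sq (|u x|) (|u (Site.shift x μ)|)
    rw [sq_abs, sq_abs] at this
    linarith
  calc ∑ x, |u x| * |u (Site.shift x μ)| ≤ ∑ x, (u x ^ 2 + u (Site.shift x μ) ^ 2) / 2 := sum_le_sum fun x _ => h1 x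
    _ = ∑ x, u x ^ 2 := by
        rw [← sum_div, sum_add_distrib, sum_shift μ (fun x => u x ^ 2)]; ring

/-- **Conjugated Dirichlet form of one direction**: `Σ_x ∂_μ(wu)·∂_μ(w⁻¹u) ≥ Σ_x (∂_μu)² − 2δ²Σ_x u²`.
[cite: Balaban1984PropagatorsI, p.36 («small perturbation of Δ_a»)] -/
theorem conjDeriv_ge {ρ : Site P 0 → ℝ} (hρ : LipX P k ρ) {δ : ℝ} (hδ0 : 0 ≤ δ) (hδ1 : δ ≤ 1)
    (μ : Fin P.d) (u : Site P 0 → ℝ) :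
    ∑ x, ((deriv P 0 ((P.L : ℝ) ^ k)⁻¹ μ *ᵥ u) x) ^ 2 - 2 * δ ^ 2 * ∑ x, u x ^ 2
      ≤ (deriv P 0 ((P.L : ℝ) ^ k)⁻¹ μ *ᵥ pmul (wt P δ ρ) u) ⬝ᵥ
          (deriv P 0 ((P.L : ℝ) ^ k)⁻¹ μ *ᵥ pmul (fun z => (wt P δ ρ z)⁻¹) u) := by
  simp only [dotProduct]
  simp_rw [deriv_conj_pointwise (wt P δ ρ) u (wt_ne_zero δ ρ) μ]
  rw [sum_sub_distrib]
  have hkey : ∑ x, (((P.L : ℝ) ^ k)⁻¹)⁻¹ ^ 2 *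
        (wt P δ ρ (Site.shift x μ) / wt P δ ρ x + wt P δ ρ x / wt P δ ρ (Site.shift x μ) - 2) *
          (u x * u (Site.shift x μ)) ≤ 2 * δ ^ 2 * ∑ x, u x ^ 2 := by
    calc ∑ x, (((P.L : ℝ) ^ k)⁻¹)⁻¹ ^ 2 *
          (wt P δ ρ (Site.shift x μ) / wt P δ ρ x + wt P δ ρ x / wt P δ ρ (Site.shift x μ) - 2) *
            (u x * u (Site.shift x μ))
        ≤ ∑ x, 2 * δ ^ 2 * (|u x| * |u (Site.shift x μ)|) := by
          refine sum_le_sum fun x _ => ?_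
          obtain ⟨h0, h2⟩ := step_coeff_bounds hρ hδ0 hδ1 x μ
          have hc0 : 0 ≤ (((P.L : ℝ) ^ k)⁻¹)⁻¹ ^ 2 *
              (wt P δ ρ (Site.shift x μ) / wt P δ ρ x + wt P δ ρ x / wt P δ ρ (Site.shift x μ) - 2) :=
            mul_nonneg (sq_nonneg _) h0
          calc _ ≤ (((P.L : ℝ) ^ k)⁻¹)⁻¹ ^ 2 *
                (wt P δ ρ (Site.shift x μ) / wt P δ ρ x + wt P δ ρ x / wt P δ ρ (Site.shift x μ) - 2) *
                  (|u x| * |u (Site.shift x μ)|) := by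
                refine mul_le_mul_of_nonneg_left ?_ hc0
                rw [← abs_mul]; exact le_abs_self _
            _ ≤ 2 * δ ^ 2 * (|u x| * |u (Site.shift x μ)|) :=
                mul_le_mul_of_nonneg_right h2 (mul_nonneg (abs_nonneg _) (abs_nonneg _))
      _ = 2 * δ ^ 2 * ∑ x, |u x| * |u (Site.shift x μ)| := by rw [mul_sum]
      _ ≤ 2 * δ ^ 2 * ∑ x, u x ^ 2 := mul_le_mul_of_nonneg_left (sum_abs_mul_shift_le μ u) (by positivity)
  linarith

/-- bilinear version of `form_hOp`: `f·(−Δ^s + m̃²)g = m̃² f·g + Σ_μ (∂_μf)·(∂_μg)`. [cite: Balaban1982Higgs1, (1.11) p.605] -/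
theorem biform_hOp (s msq : ℝ) (f g : Site P 0 → ℝ) :
    f ⬝ᵥ (hOp P 0 s msq *ᵥ g) = msq * (f ⬝ᵥ g) + ∑ μ, (deriv P 0 s μ *ᵥ f) ⬝ᵥ (deriv P 0 s μ *ᵥ g) := by
  rw [hOp_mulVec, dotProduct_add, dotProduct_smul, smul_eq_mul, dotProduct_sum]
  congr 1
  refine sum_congr rfl fun μ _ => ?_
  rw [Matrix.dotProduct_mulVec, Matrix.vecMul_transpose]

/-- `(wu)·(w⁻¹u) = u·u`. [folklore] -/
private theorem pmul_dot_pmul_inv (w u : Site P 0 → ℝ) (hw : ∀ z, w z ≠ 0) :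
    pmul w u ⬝ᵥ pmul (fun z => (w z)⁻¹) u = u ⬝ᵥ u := by
  simp only [dotProduct, pmul_apply]
  refine sum_congr rfl fun x _ => ?_
  have := hw x
  field_simp

/-- `u·u = Σ u²`. [cite: Balaban1984PropagatorsI, Prop. 1.1 (1.89)–(1.90) p.33] -/
theorem dot_self_eq_sum_sq {ι : Type*} [Fintype ι] (u : ι → ℝ) : u ⬝ᵥ u = ∑ x, u x ^ 2 := by
  simp only [dotProduct, sq]

/-- **Conjugated form of `−Δ^η + m̃²`**: `(wu)·(−Δ^η + m̃²)(w⁻¹u) ≥ u·(−Δ^η + m̃²)u − 2dδ²·Σu²`.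
[cite: Balaban1984PropagatorsI, p.36 («e^{−⟨q,x⟩}Δ_a e^{⟨q,x⟩} − Δ_a is a small perturbation of Δ_a»)] -/
theorem conjLap_ge {ρ : Site P 0 → ℝ} (hρ : LipX P k ρ) {δ : ℝ} (hδ0 : 0 ≤ δ) (hδ1 : δ ≤ 1) (msq : ℝ)
    (u : Site P 0 → ℝ) :
    u ⬝ᵥ (hOp P 0 ((P.L : ℝ) ^ k)⁻¹ msq *ᵥ u) - 2 * P.d * δ ^ 2 * ∑ x, u x ^ 2
      ≤ pmul (wt P δ ρ) u ⬝ᵥ (hOp P 0 ((P.L : ℝ) ^ k)⁻¹ msq *ᵥ pmul (fun z => (wt P δ ρ z)⁻¹) u) := by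
  rw [biform_hOp, biform_hOp, pmul_dot_pmul_inv _ _ (wt_ne_zero δ ρ)]
  have h := fun μ => conjDeriv_ge hρ hδ0 hδ1 μ u
  have hsum := sum_le_sum fun μ (_ : μ ∈ (univ : Finset (Fin P.d))) => h μ
  rw [sum_sub_distrib, sum_const, card_univ, Fintype.card_fin, nsmul_eq_mul] at hsum
  have e : ∀ μ, (deriv P 0 ((P.L : ℝ) ^ k)⁻¹ μ *ᵥ u) ⬝ᵥ (deriv P 0 ((P.L : ℝ) ^ k)⁻¹ μ *ᵥ u)
      = ∑ x, ((deriv P 0 ((P.L : ℝ) ^ k)⁻¹ μ *ᵥ u) x) ^ 2 := fun μ => dot_self_eq_sum_sq _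
  simp_rw [e]
  linarith

end Laplacian

/-! ## §4 The conjugated averaging form a·Q*_μQ_μ -/

section Averaging

variable {k : ℕ}

/-- Row sums of `Q_μ`: `Σ_x Q_μ(y, x) = 1` (Q_μ of the constant 1 is 1). [cite: Balaban1984PropagatorsI, (1.18) p.20] -/
theorem Qv_rowsum (hk : k ≤ P.m + P.K) (μ : Fin P.d) (y : Site P k) : ∑ x, Qv P k μ y x = 1 := by
  have h := congrFun (Qv_const (P := P) hk μ 1) y
  simpa [Matrix.mulVec, dotProduct] using h

/-- **Schur bound for `Q_μ`**: `Σ_y (Q_μf)(y)² ≤ η^d Σ_x f(x)²` (row sums 1, column sums η^d, entries ≥ 0) — i.e.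
`‖Q_μf‖_{ℓ²(T₁)} ≤ ‖f‖_{L²(T_η)}`. [cite: Balaban1984PropagatorsI, (1.18) p.20] -/
theorem sum_sq_Qv_mulVec_le (hk : k ≤ P.m + P.K) (μ : Fin P.d) (f : Site P 0 → ℝ) :
    ∑ y, ((Qv P k μ *ᵥ f) y) ^ 2 ≤ (((P.L : ℝ) ^ k)⁻¹) ^ P.d * ∑ x, f x ^ 2 := by
  have hq := Qv_nonneg (P := P) k μ
  have hy : ∀ y, ((Qv P k μ *ᵥ f) y) ^ 2 ≤ ∑ x, Qv P k μ y x * f x ^ 2 := by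
    intro y
    have hcs := sum_mul_sq_le_sq_mul_sq (univ : Finset (Site P 0))
      (fun x => Real.sqrt (Qv P k μ y x)) (fun x => Real.sqrt (Qv P k μ y x) * f x)
    have e1 : ∀ x, Real.sqrt (Qv P k μ y x) * (Real.sqrt (Qv P k μ y x) * f x) = Qv P k μ y x * f x := by
      intro x; rw [← mul_assoc, Real.mul_self_sqrt (hq y x)]
    have e2 : ∀ x, Real.sqrt (Qv P k μ y x) ^ 2 = Qv P k μ y x := fun x => Real.sq_sqrt (hq y x)
    have e3 : ∀ x, (Real.sqrt (Qv P k μ y x) * f x) ^ 2 = Qv P k μ y x * f x ^ 2 := by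
      intro x; rw [mul_pow, e2]
    simp_rw [e1, e2, e3, Qv_rowsum hk μ y, one_mul] at hcs
    simpa [Matrix.mulVec, dotProduct] using hcs
  calc ∑ y, ((Qv P k μ *ᵥ f) y) ^ 2 ≤ ∑ y, ∑ x, Qv P k μ y x * f x ^ 2 := sum_le_sum fun y _ => hy y
    _ = ∑ x, (∑ y, Qv P k μ y x) * f x ^ 2 := by rw [sum_comm]; simp_rw [sum_mul]
    _ = (((P.L : ℝ) ^ k)⁻¹) ^ P.d * ∑ x, f x ^ 2 := by simp_rw [Qv_colsum hk μ, ← mul_sum]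

/-- The unweighted bilinear form of `Q*_μQ_μ`: `φ·Q*_μ(Q_μψ) = L^{dk}·(Q_μφ)·(Q_μψ)` (Q*_μ = η^{−d}Q_μᵀ).
[cite: Balaban1984PropagatorsI, (1.132) p.39] -/
theorem dot_QvTQv (k : ℕ) (μ : Fin P.d) (φ ψ : Site P 0 → ℝ) :
    φ ⬝ᵥ (QvT P k μ *ᵥ (Qv P k μ *ᵥ ψ)) = ((P.L : ℝ) ^ P.d) ^ lvl P k * ((Qv P k μ *ᵥ φ) ⬝ᵥ (Qv P k μ *ᵥ ψ)) := by
  rw [QvT, Matrix.smul_mulVec, dotProduct_smul, smul_eq_mul, Matrix.dotProduct_mulVec, Matrix.vecMul_transpose]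

/-- `L^{dk}·η^d = 1` on Bałaban's levels. [cite: Balaban1984PropagatorsI, (1.18) p.20] -/
theorem Lpow_mul_eta_pow (hk : k ≤ P.m + P.K) :
    ((P.L : ℝ) ^ P.d) ^ lvl P k * (((P.L : ℝ) ^ k)⁻¹) ^ P.d = 1 := by
  rw [lvl_of_le P hk, inv_pow, ← pow_mul, ← pow_mul, mul_comm k P.d,
    mul_inv_cancel₀ (pow_ne_zero _ P.cast_L_pos.ne')]

/-- the termwise inequality behind the symmetrization of the conjugated averaging form. [folklore] -/
private theorem term_ineq {q q' t c u u' : ℝ} (hq : 0 ≤ q) (hq' : 0 ≤ q') (ht0 : 0 ≤ t + t⁻¹ - 2)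
    (ht : t + t⁻¹ - 2 ≤ c) :
    2 * (q * q' * (u * u')) - c * (q * q' * (|u| * |u'|))
      ≤ q * q' * (t * (u * u')) + q * q' * (t⁻¹ * (u * u')) := by
  have hqq : 0 ≤ q * q' := mul_nonneg hq hq'
  have h1 : (t + t⁻¹ - 2) * (u * u') ≥ -(c * (|u| * |u'|)) := by
    have hab : |(t + t⁻¹ - 2) * (u * u')| ≤ c * (|u| * |u'|) := by
      rw [abs_mul, abs_of_nonneg ht0, abs_mul]
      exact mul_le_mul_of_nonneg_right ht (mul_nonneg (abs_nonneg _) (abs_nonneg _))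
    have := neg_abs_le ((t + t⁻¹ - 2) * (u * u'))
    linarith
  nlinarith

/-- **Conjugated averaging, one block**: with `w = e^{δρ}`, ρ Lipschitz and 4δ ≤ 1,
`(Q_μ(wu))(y)·(Q_μ(w⁻¹u))(y) ≥ (Q_μu)(y)² − 16δ²(Q_μ|u|)(y)²` (the points on the support of Q_μ(y,·) differ in ρ by ≤ 4).
[cite: Balaban1984PropagatorsI, p.36 («small perturbation of Δ_a»), (1.18) p.20] -/
theorem conjQ_fibre {ρ : Site P 0 → ℝ} (hρ : LipX P k ρ) (hk : k ≤ P.m + P.K) {δ : ℝ} (hδ0 : 0 ≤ δ)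
    (hδ4 : 4 * δ ≤ 1) (μ : Fin P.d) (y : Site P k) (u : Site P 0 → ℝ) :
    ((Qv P k μ *ᵥ u) y) ^ 2 - 16 * δ ^ 2 * ((Qv P k μ *ᵥ fun x => |u x|) y) ^ 2
      ≤ (Qv P k μ *ᵥ pmul (wt P δ ρ) u) y * (Qv P k μ *ᵥ pmul (fun z => (wt P δ ρ z)⁻¹) u) y := by
  set q : Site P 0 → ℝ := fun x => Qv P k μ y x with hqdef
  have hq : ∀ x, 0 ≤ q x := fun x => Qv_nonneg k μ y x
  set w := wt P δ ρ with hwdef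
  have hw : ∀ z, w z ≠ 0 := wt_ne_zero δ ρ
  -- the four double sums
  have hAB : (Qv P k μ *ᵥ pmul w u) y * (Qv P k μ *ᵥ pmul (fun z => (w z)⁻¹) u) y
      = ∑ x, ∑ x', q x * q x' * ((w x / w x') * (u x * u x')) := by
    simp only [Matrix.mulVec, dotProduct, pmul_apply, sum_mul_sum]
    refine sum_congr rfl fun x _ => sum_congr rfl fun x' _ => ?_
    rw [div_eq_mul_inv]; ring
  have hBA : (Qv P k μ *ᵥ pmul w u) y * (Qv P k μ *ᵥ pmul (fun z => (w z)⁻¹) u) y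
      = ∑ x, ∑ x', q x * q x' * ((w x / w x')⁻¹ * (u x * u x')) := by
    rw [mul_comm]
    simp only [Matrix.mulVec, dotProduct, pmul_apply, sum_mul_sum]
    refine sum_congr rfl fun x _ => sum_congr rfl fun x' _ => ?_
    rw [inv_div, div_eq_mul_inv]; ring
  have hsq : ((Qv P k μ *ᵥ u) y) ^ 2 = ∑ x, ∑ x', q x * q x' * (u x * u x') := by
    simp only [Matrix.mulVec, dotProduct, sq, sum_mul_sum]
    refine sum_congr rfl fun x _ => sum_congr rfl fun x' _ => ?_
    ring
  have habs : ((Qv P k μ *ᵥ fun x => |u x|) y) ^ 2 = ∑ x, ∑ x', q x * q x' * (|u x| * |u x'|) := by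
    simp only [Matrix.mulVec, dotProduct, sq, sum_mul_sum]
    refine sum_congr rfl fun x _ => sum_congr rfl fun x' _ => ?_
    ring
  -- termwise
  have hterm : ∀ x x', 2 * (q x * q x' * (u x * u x')) - 32 * δ ^ 2 * (q x * q x' * (|u x| * |u x'|))
      ≤ q x * q x' * ((w x / w x') * (u x * u x')) + q x * q x' * ((w x / w x')⁻¹ * (u x * u x')) := by
    intro x x'
    by_cases hx : Qv P k μ y x = 0
    · have : q x = 0 := hx
      rw [this]; simp
    by_cases hx' : Qv P k μ y x' = 0
    · have : q x' = 0 := hx'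
      rw [this]; simp
    have hρ4 := hρ.abs_sub_le_four_of_Qv hk hx hx'
    set σ := δ * (ρ x - ρ x') with hσ
    have ht : w x / w x' = Real.exp σ := wt_div δ ρ x' x
    have hσ1 : |σ| ≤ 1 := by
      rw [hσ, abs_mul, abs_of_nonneg hδ0]
      calc δ * |ρ x - ρ x'| ≤ δ * 4 := mul_le_mul_of_nonneg_left hρ4 hδ0
        _ ≤ 1 := by linarith
    have hb := ratio_add_inv_sub_two_le hσ1
    have hσsq : σ ^ 2 ≤ (4 * δ) ^ 2 := by
      rw [← sq_abs σ]
      refine pow_le_pow_left₀ (abs_nonneg σ) ?_ 2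
      rw [hσ, abs_mul, abs_of_nonneg hδ0]
      calc δ * |ρ x - ρ x'| ≤ δ * 4 := mul_le_mul_of_nonneg_left hρ4 hδ0
        _ = 4 * δ := by ring
    rw [ht]
    exact term_ineq (hq x) (hq x') (ratio_add_inv_sub_two_nonneg σ) (hb.trans (by nlinarith))
  have hsum := sum_le_sum fun x (_ : x ∈ (univ : Finset (Site P 0))) =>
    sum_le_sum fun x' (_ : x' ∈ (univ : Finset (Site P 0))) => hterm x x'
  simp only [sum_sub_distrib, ← mul_sum, sum_add_distrib] at hsum
  rw [← hsq, ← habs, ← hAB, ← hBA] at hsum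
  linarith

/-- **Conjugated form of `Q*_μQ_μ`**: `(wu)·Q*_μQ_μ(w⁻¹u) ≥ u·Q*_μQ_μu − 16δ²Σu²`.
[cite: Balaban1984PropagatorsI, p.36 («small perturbation of Δ_a»), (1.132) p.39] -/
theorem conjQ_ge {ρ : Site P 0 → ℝ} (hρ : LipX P k ρ) (hk : k ≤ P.m + P.K) {δ : ℝ} (hδ0 : 0 ≤ δ)
    (hδ4 : 4 * δ ≤ 1) (μ : Fin P.d) (u : Site P 0 → ℝ) :
    u ⬝ᵥ (QvT P k μ *ᵥ (Qv P k μ *ᵥ u)) - 16 * δ ^ 2 * ∑ x, u x ^ 2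
      ≤ pmul (wt P δ ρ) u ⬝ᵥ (QvT P k μ *ᵥ (Qv P k μ *ᵥ pmul (fun z => (wt P δ ρ z)⁻¹) u)) := by
  rw [dot_QvTQv, dot_QvTQv]
  set c := ((P.L : ℝ) ^ P.d) ^ lvl P k with hc
  have hc0 : 0 ≤ c := by positivity
  have hfib := fun y => conjQ_fibre hρ hk hδ0 hδ4 μ y u
  have hS := sum_sq_Qv_mulVec_le hk μ (fun x => |u x|)
  simp_rw [sq_abs] at hS
  have h1 : c * ((Qv P k μ *ᵥ u) ⬝ᵥ (Qv P k μ *ᵥ u)) - 16 * δ ^ 2 * (c * ∑ y, ((Qv P k μ *ᵥ fun x => |u x|) y) ^ 2)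
      ≤ c * ((Qv P k μ *ᵥ pmul (wt P δ ρ) u) ⬝ᵥ (Qv P k μ *ᵥ pmul (fun z => (wt P δ ρ z)⁻¹) u)) := by
    have hsum := sum_le_sum fun y (_ : y ∈ (univ : Finset (Site P k))) => hfib y
    rw [sum_sub_distrib, ← mul_sum] at hsum
    have := mul_le_mul_of_nonneg_left hsum hc0
    rw [dot_self_eq_sum_sq]
    unfold dotProduct
    linarith
  have h2 : c * ∑ y, ((Qv P k μ *ᵥ fun x => |u x|) y) ^ 2 ≤ ∑ x, u x ^ 2 := by
    calc c * ∑ y, ((Qv P k μ *ᵥ fun x => |u x|) y) ^ 2 ≤ c * ((((P.L : ℝ) ^ k)⁻¹) ^ P.d * ∑ x, u x ^ 2) :=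
          mul_le_mul_of_nonneg_left hS hc0
      _ = ∑ x, u x ^ 2 := by rw [← mul_assoc, hc, Lpow_mul_eta_pow hk, one_mul]
  have hδ2 : 0 ≤ 16 * δ ^ 2 := by positivity
  have h3 := mul_le_mul_of_nonneg_left h2 hδ2
  linarith

end Averaging

/-! ## §5 The conjugated form of `M0`, coercivity (1.90), and the weighted solves -/

section Solve

variable {k : ℕ}

variable (P) in
/-- `Σ_x u(x)²` (unweighted; the L²(T_η) norm squared is η^d times this). [cite: Balaban1984PropagatorsI, (1.89) p.33] -/
def nsq (u : Site P 0 → ℝ) : ℝ := ∑ x, u x ^ 2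

variable (P) in
/-- `Σ_μ Σ_x (∂^η_μu)(x)²` (unweighted Dirichlet form, η = L^{−k}). [cite: Balaban1984PropagatorsI, (1.90) p.33 («Δ + I»)] -/
def dirE (k : ℕ) (u : Site P 0 → ℝ) : ℝ := ∑ μ, ∑ x, ((deriv P 0 ((P.L : ℝ) ^ k)⁻¹ μ *ᵥ u) x) ^ 2

/-- `0 ≤ Σu²`. [cite: Balaban1984PropagatorsI, Prop. 1.1 (1.89)–(1.90) p.33] -/
theorem nsq_nonneg (u : Site P 0 → ℝ) : 0 ≤ nsq P u := sum_nonneg fun _ _ => sq_nonneg _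

/-- `0 ≤ Σ_μΣ(∂_μu)²`. [cite: Balaban1984PropagatorsI, Prop. 1.1 (1.89)–(1.90) p.33] -/
theorem dirE_nonneg (k : ℕ) (u : Site P 0 → ℝ) : 0 ≤ dirE P k u :=
  sum_nonneg fun _ _ => sum_nonneg fun _ _ => sq_nonneg _

/-- `Σu² = u·u`. [cite: Balaban1984PropagatorsI, Prop. 1.1 (1.89)–(1.90) p.33] -/
theorem nsq_eq_dot (u : Site P 0 → ℝ) : nsq P u = u ⬝ᵥ u := (dot_self_eq_sum_sq u).symm

/-- one direction of the Dirichlet form is below the whole. [cite: Balaban1984PropagatorsI, Prop. 1.1 (1.89)–(1.90) p.33] -/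
theorem sum_sq_deriv_le_dirE (k : ℕ) (μ : Fin P.d) (u : Site P 0 → ℝ) :
    ∑ x, ((deriv P 0 ((P.L : ℝ) ^ k)⁻¹ μ *ᵥ u) x) ^ 2 ≤ dirE P k u := by
  unfold dirE
  exact single_le_sum (f := fun μ => ∑ x, ((deriv P 0 ((P.L : ℝ) ^ k)⁻¹ μ *ᵥ u) x) ^ 2)
    (fun μ _ => sum_nonneg fun x _ => sq_nonneg _) (mem_univ μ)

/-- Cauchy–Schwarz for the unweighted sums: `f·g ≤ √(Σf²)·√(Σg²)`. [cite: Balaban1984PropagatorsI, Prop. 1.1 (1.89)–(1.90) p.33] -/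
theorem dot_le_sqrt_nsq (f g : Site P 0 → ℝ) : f ⬝ᵥ g ≤ Real.sqrt (nsq P f) * Real.sqrt (nsq P g) := by
  have h := sum_mul_sq_le_sq_mul_sq (univ : Finset (Site P 0)) f g
  calc f ⬝ᵥ g ≤ |f ⬝ᵥ g| := le_abs_self _
    _ = Real.sqrt ((f ⬝ᵥ g) ^ 2) := (Real.sqrt_sq_eq_abs _).symm
    _ ≤ Real.sqrt (nsq P f * nsq P g) := Real.sqrt_le_sqrt (by simpa [dotProduct, nsq] using h)
    _ = Real.sqrt (nsq P f) * Real.sqrt (nsq P g) := Real.sqrt_mul (nsq_nonneg f) _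

/-- `|f|·|g| ≤ √(Σf²)·√(Σg²)` termwise-absolute version. [cite: Balaban1984PropagatorsI, Prop. 1.1 (1.89)–(1.90) p.33] -/
theorem sum_abs_mul_abs_le_sqrt_nsq (f g : Site P 0 → ℝ) :
    ∑ x, |f x| * |g x| ≤ Real.sqrt (nsq P f) * Real.sqrt (nsq P g) := by
  have h := dot_le_sqrt_nsq (fun x => |f x|) (fun x => |g x|)
  simp only [dotProduct, nsq, sq_abs] at h ⊢
  exact h

/-- the bilinear form of `M0` with the deriv scale written as η = L^{−k}. [cite: Balaban1984PropagatorsI, (1.132) p.39] -/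
theorem biform_M0 (a msq : ℝ) (μ : Fin P.d) (f g : Site P 0 → ℝ) :
    f ⬝ᵥ (M0 P a msq k μ *ᵥ g)
      = f ⬝ᵥ (hOp P 0 ((P.L : ℝ) ^ k)⁻¹ (P.spacing k ^ 2 * msq) *ᵥ g) + a * (f ⬝ᵥ (QvT P k μ *ᵥ (Qv P k μ *ᵥ g))) := by
  rw [M0, eps_div_spacing, Matrix.add_mulVec, Matrix.smul_mulVec, ← Matrix.mulVec_mulVec, dotProduct_add,
    dotProduct_smul, smul_eq_mul]

/-- **Conjugated form of `M0 = −Δ^η + (Lᵏε)²m² + aQ*_μQ_μ`**: `(wu)·M0(w⁻¹u) ≥ u·M0u − (2d + 16a)δ²Σu²` — «e^{−⟨q,x⟩}Δ_a e^{⟨q,x⟩}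
− Δ_a is a small perturbation of Δ_a for vectors q sufficiently small», in quadratic-form sense, on the torus, for G₀.
[cite: Balaban1984PropagatorsI, p.36] -/
theorem conjM0_ge {ρ : Site P 0 → ℝ} (hρ : LipX P k ρ) (hk : k ≤ P.m + P.K) {a : ℝ} (ha : 0 ≤ a) {δ : ℝ}
    (hδ0 : 0 ≤ δ) (hδ4 : 4 * δ ≤ 1) (msq : ℝ) (μ : Fin P.d) (u : Site P 0 → ℝ) :
    u ⬝ᵥ (M0 P a msq k μ *ᵥ u) - (2 * P.d + 16 * a) * δ ^ 2 * nsq P u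
      ≤ pmul (wt P δ ρ) u ⬝ᵥ (M0 P a msq k μ *ᵥ pmul (fun z => (wt P δ ρ z)⁻¹) u) := by
  rw [biform_M0, biform_M0]
  have h1 := conjLap_ge hρ hδ0 (by linarith) (P.spacing k ^ 2 * msq) u
  have h2 := mul_le_mul_of_nonneg_left (conjQ_ge hρ hk hδ0 hδ4 μ u) ha
  unfold nsq
  nlinarith

/-- `lapEta` with the deriv scale written as η = L^{−k}. [cite: Balaban1984PropagatorsI, p.21 (Δ)] -/
theorem lapEta_eq (k : ℕ) : lapEta P k = hOp P 0 ((P.L : ℝ) ^ k)⁻¹ 0 := by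
  rw [lapEta, eps_div_spacing]

/-- `u·(Δ + 1)u = Σ_μ‖∂_μu‖² + ‖u‖²` (the form of (1.90)'s right side, unweighted). [cite: Balaban1984PropagatorsI, (1.90) p.33] -/
theorem form_lapEta_add_one (u : Site P 0 → ℝ) :
    u ⬝ᵥ ((lapEta P k + 1) *ᵥ u) = dirE P k u + nsq P u := by
  rw [Matrix.add_mulVec, Matrix.one_mulVec, dotProduct_add, lapEta_eq, biform_hOp, zero_mul, zero_add,
    nsq_eq_dot]
  unfold dirE
  congr 1
  exact sum_congr rfl fun μ _ => dot_self_eq_sum_sq _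

/-- from `γ/2·X² ≤ X·W` (X, W ≥ 0, γ > 0) to `X² ≤ (2/γ)²W²`. [cite: Balaban1984PropagatorsI, p.36 («e^{−⟨q,x⟩}Δ_a e^{⟨q,x⟩} − Δ_a … small perturbation of Δ_a»)] -/
theorem sq_le_of_quad {γ X W : ℝ} (hγ : 0 < γ) (hX : 0 ≤ X) (hW : 0 ≤ W) (h : γ / 2 * X ^ 2 ≤ X * W) :
    X ^ 2 ≤ (2 / γ) ^ 2 * W ^ 2 := by
  have h1 : X ≤ 2 / γ * W := by
    by_cases hX0 : X = 0
    · rw [hX0]; positivity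
    · have hXp : 0 < X := lt_of_le_of_ne hX (Ne.symm hX0)
      have h2 : γ / 2 * X ≤ W := by
        have : γ / 2 * X * X ≤ W * X := by nlinarith
        exact le_of_mul_le_mul_right this hXp
      rw [div_mul_eq_mul_div, le_div_iff₀ hγ]
      linarith
  calc X ^ 2 ≤ (2 / γ * W) ^ 2 := pow_le_pow_left₀ hX h1 2
    _ = (2 / γ) ^ 2 * W ^ 2 := by ring

/-- `pmul w (pmul w⁻¹ ·)` bookkeeping: `w⁻¹·(w·v) = v`. [cite: Balaban1984PropagatorsI, p.36 («e^{−⟨q,x⟩}Δ_a e^{⟨q,x⟩} − Δ_a … small perturbation of Δ_a»)] -/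
theorem pmul_inv_pmul (w v : Site P 0 → ℝ) (hw : ∀ z, w z ≠ 0) :
    pmul (fun z => (w z)⁻¹) (pmul w v) = v := by
  funext x; simp only [pmul_apply]; rw [← mul_assoc, inv_mul_cancel₀ (hw x), one_mul]

/-- `(w·(w·v))·(M v) = (w·v)·(w·(Mv))` pointwise regrouping. [cite: Balaban1984PropagatorsI, p.36 («e^{−⟨q,x⟩}Δ_a e^{⟨q,x⟩} − Δ_a … small perturbation of Δ_a»)] -/
theorem pmul_pmul_dot (w v h : Site P 0 → ℝ) : pmul w (pmul w v) ⬝ᵥ h = pmul w v ⬝ᵥ pmul w h := by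
  simp only [dotProduct, pmul_apply]; exact sum_congr rfl fun x _ => by ring

/-- **THE WEIGHTED SOLVE** (the core estimate of the p. 36 route for G₀): under (1.90) `γ₀(Δ + I) ≤ G₀⁻¹` and
`(2d + 16a)δ² ≤ γ₀/2`, for every source g, with v = G₀g and u = e^{δρ}v:
`Σ_μ‖∂_μu‖² + ‖u‖² ≤ (2/γ₀)²·‖e^{δρ}g‖²` (unweighted sums). [cite: Balaban1984PropagatorsI, p.36, (1.90) p.33] -/
theorem solve_bound {ρ : Site P 0 → ℝ} (hρ : LipX P k ρ) (hk : k ≤ P.m + P.K) {a msq : ℝ} (ha : 0 < a)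
    (hm : 0 ≤ msq) (μ : Fin P.d) {γ₀ : ℝ} (hγ : 0 < γ₀)
    (hco : ∀ f : Site P 0 → ℝ, γ₀ * (f ⬝ᵥ ((lapEta P k + 1) *ᵥ f)) ≤ f ⬝ᵥ (M0 P a msq k μ *ᵥ f))
    {δ : ℝ} (hδ0 : 0 ≤ δ) (hδ4 : 4 * δ ≤ 1) (hδγ : (2 * P.d + 16 * a) * δ ^ 2 ≤ γ₀ / 2)
    (g : Site P 0 → ℝ) :
    dirE P k (pmul (wt P δ ρ) (G0 P a msq k μ *ᵥ g)) + nsq P (pmul (wt P δ ρ) (G0 P a msq k μ *ᵥ g))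
      ≤ (2 / γ₀) ^ 2 * nsq P (pmul (wt P δ ρ) g) := by
  set w := wt P δ ρ with hw
  set v := G0 P a msq k μ *ᵥ g with hv
  set u := pmul w v with hu
  have hMv : M0 P a msq k μ *ᵥ v = g := by
    rw [hv, Matrix.mulVec_mulVec, M0_mul_G0 ha hm hk, Matrix.one_mulVec]
  -- the conjugated form evaluated: (w u)·M0(w⁻¹ u) = u·(w g)
  have hform : pmul w u ⬝ᵥ (M0 P a msq k μ *ᵥ pmul (fun z => (w z)⁻¹) u) = u ⬝ᵥ pmul w g := by
    rw [hu, pmul_inv_pmul w v (wt_ne_zero δ ρ), hMv, pmul_pmul_dot]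
  have hconj := conjM0_ge hρ hk ha.le hδ0 hδ4 msq μ u
  have hcoe := hco u
  rw [form_lapEta_add_one] at hcoe
  have hX2 : 0 ≤ dirE P k u + nsq P u := add_nonneg (dirE_nonneg k u) (nsq_nonneg u)
  set X := Real.sqrt (dirE P k u + nsq P u) with hX
  set W := Real.sqrt (nsq P (pmul w g)) with hW
  have hXsq : X ^ 2 = dirE P k u + nsq P u := Real.sq_sqrt hX2
  have hWsq : W ^ 2 = nsq P (pmul w g) := Real.sq_sqrt (nsq_nonneg _)
  have hcs : u ⬝ᵥ pmul w g ≤ Real.sqrt (nsq P u) * W := dot_le_sqrt_nsq u (pmul w g)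
  have hnu : Real.sqrt (nsq P u) ≤ X := Real.sqrt_le_sqrt (by linarith [dirE_nonneg k u])
  have hW0 : 0 ≤ W := Real.sqrt_nonneg _
  have hmain : γ₀ / 2 * X ^ 2 ≤ X * W := by
    rw [hXsq]
    have hδn : (2 * P.d + 16 * a) * δ ^ 2 * nsq P u ≤ γ₀ / 2 * nsq P u :=
      mul_le_mul_of_nonneg_right hδγ (nsq_nonneg u)
    calc γ₀ / 2 * (dirE P k u + nsq P u)
        ≤ u ⬝ᵥ (M0 P a msq k μ *ᵥ u) - (2 * P.d + 16 * a) * δ ^ 2 * nsq P u := by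
          nlinarith [dirE_nonneg k u]
      _ ≤ u ⬝ᵥ pmul w g := by rw [← hform]; exact hconj
      _ ≤ Real.sqrt (nsq P u) * W := hcs
      _ ≤ X * W := mul_le_mul_of_nonneg_right hnu hW0
  have := sq_le_of_quad hγ (Real.sqrt_nonneg _) hW0 hmain
  rwa [hXsq, hWsq] at this

/-- **the cap-free mass bound**: with the same data, `(Lᵏε)²m²·‖u‖ ≤ 2‖e^{δρ}g‖`. [cite: Balaban1984PropagatorsI, p.36, (1.90) p.33] -/
theorem mass_bound {ρ : Site P 0 → ℝ} (hρ : LipX P k ρ) (hk : k ≤ P.m + P.K) {a msq : ℝ} (ha : 0 < a)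
    (hm : 0 ≤ msq) (μ : Fin P.d) {γ₀ : ℝ} (hγ : 0 < γ₀)
    (hco : ∀ f : Site P 0 → ℝ, γ₀ * (f ⬝ᵥ ((lapEta P k + 1) *ᵥ f)) ≤ f ⬝ᵥ (M0 P a msq k μ *ᵥ f))
    {δ : ℝ} (hδ0 : 0 ≤ δ) (hδ4 : 4 * δ ≤ 1) (hδγ : (2 * P.d + 16 * a) * δ ^ 2 ≤ γ₀ / 2)
    (g : Site P 0 → ℝ) :
    P.spacing k ^ 2 * msq * Real.sqrt (nsq P (pmul (wt P δ ρ) (G0 P a msq k μ *ᵥ g)))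
      ≤ 2 * Real.sqrt (nsq P (pmul (wt P δ ρ) g)) := by
  set w := wt P δ ρ with hw
  set v := G0 P a msq k μ *ᵥ g with hv
  set u := pmul w v with hu
  have hMv : M0 P a msq k μ *ᵥ v = g := by
    rw [hv, Matrix.mulVec_mulVec, M0_mul_G0 ha hm hk, Matrix.one_mulVec]
  have hform : pmul w u ⬝ᵥ (M0 P a msq k μ *ᵥ pmul (fun z => (w z)⁻¹) u) = u ⬝ᵥ pmul w g := by
    rw [hu, pmul_inv_pmul w v (wt_ne_zero δ ρ), hMv, pmul_pmul_dot]
  -- lower bound of the conjugated form by the mass term alone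
  have hmt : P.spacing k ^ 2 * msq * nsq P u - (2 * P.d + 16 * a) * δ ^ 2 * nsq P u
      ≤ pmul w u ⬝ᵥ (M0 P a msq k μ *ᵥ pmul (fun z => (w z)⁻¹) u) := by
    rw [biform_M0, biform_hOp, pmul_dot_pmul_inv _ _ (wt_ne_zero δ ρ), dot_QvTQv, ← nsq_eq_dot]
    -- Laplacian part
    have hL := fun ν => conjDeriv_ge hρ hδ0 (by linarith) ν u
    have hsum := sum_le_sum fun ν (_ : ν ∈ (univ : Finset (Fin P.d))) => hL ν
    rw [sum_sub_distrib, sum_const, card_univ, Fintype.card_fin, nsmul_eq_mul] at hsum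
    have hdir0 : 0 ≤ ∑ ν : Fin P.d, ∑ x, ((deriv P 0 ((P.L : ℝ) ^ k)⁻¹ ν *ᵥ u) x) ^ 2 :=
      sum_nonneg fun _ _ => sum_nonneg fun _ _ => sq_nonneg _
    -- averaging part
    have hQ := fun y => conjQ_fibre hρ hk hδ0 hδ4 μ y u
    have hQs := sum_le_sum fun y (_ : y ∈ (univ : Finset (Site P k))) => hQ y
    rw [sum_sub_distrib, ← mul_sum] at hQs
    have hQc : ∑ y, ((Qv P k μ *ᵥ u) y) ^ 2 - 16 * δ ^ 2 * ∑ y, ((Qv P k μ *ᵥ fun x => |u x|) y) ^ 2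
        ≤ (Qv P k μ *ᵥ pmul w u) ⬝ᵥ (Qv P k μ *ᵥ pmul (fun z => (w z)⁻¹) u) := by
      unfold dotProduct; exact hQs
    have hS := sum_sq_Qv_mulVec_le hk μ (fun x => |u x|)
    simp_rw [sq_abs] at hS
    set c := ((P.L : ℝ) ^ P.d) ^ lvl P k with hc
    have hc0 : 0 ≤ c := by positivity
    have h2 : c * ∑ y, ((Qv P k μ *ᵥ fun x => |u x|) y) ^ 2 ≤ nsq P u := by
      calc c * ∑ y, ((Qv P k μ *ᵥ fun x => |u x|) y) ^ 2 ≤ c * ((((P.L : ℝ) ^ k)⁻¹) ^ P.d * ∑ x, u x ^ 2) :=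
            mul_le_mul_of_nonneg_left hS hc0
        _ = nsq P u := by rw [← mul_assoc, hc, Lpow_mul_eta_pow hk, one_mul]; rfl
    have hq0 : 0 ≤ ∑ y, ((Qv P k μ *ᵥ u) y) ^ 2 := sum_nonneg fun _ _ => sq_nonneg _
    have hac : 0 ≤ a * c := mul_nonneg ha.le hc0
    have hQac := mul_le_mul_of_nonneg_left hQc hac
    have h3 := mul_le_mul_of_nonneg_left h2 (show 0 ≤ a * (16 * δ ^ 2) by positivity)
    have h4 : 0 ≤ a * c * ∑ y, ((Qv P k μ *ᵥ u) y) ^ 2 := mul_nonneg hac hq0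
    have hn := nsq_nonneg (P := P) u
    unfold nsq at h2 h3 hn ⊢
    nlinarith
  have hsb := solve_bound hρ hk ha hm μ hγ hco hδ0 hδ4 hδγ g
  have hnu0 := nsq_nonneg (P := P) u
  set N := Real.sqrt (nsq P u) with hN
  set W := Real.sqrt (nsq P (pmul w g)) with hW
  have hNsq : N ^ 2 = nsq P u := Real.sq_sqrt hnu0
  have hWsq : W ^ 2 = nsq P (pmul w g) := Real.sq_sqrt (nsq_nonneg _)
  have hN0 : 0 ≤ N := Real.sqrt_nonneg _
  have hW0 : 0 ≤ W := Real.sqrt_nonneg _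
  have hcs : u ⬝ᵥ pmul w g ≤ N * W := dot_le_sqrt_nsq u (pmul w g)
  have hNW : N ≤ 2 / γ₀ * W := by
    have h1 : N ^ 2 ≤ (2 / γ₀) ^ 2 * W ^ 2 := by
      rw [hNsq, hWsq]; linarith [dirE_nonneg k u]
    have h2 : N ^ 2 ≤ (2 / γ₀ * W) ^ 2 := by rw [mul_pow]; exact h1
    exact (pow_le_pow_iff_left₀ hN0 (by positivity) two_ne_zero).mp h2
  have hm0 : 0 ≤ P.spacing k ^ 2 * msq := mul_nonneg (sq_nonneg _) hm
  have hδn : (2 * P.d + 16 * a) * δ ^ 2 * nsq P u ≤ γ₀ / 2 * nsq P u :=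
    mul_le_mul_of_nonneg_right hδγ hnu0
  -- m̃ N² ≤ N W + (γ₀/2) N² ≤ N W + (γ₀/2) N (2/γ₀) W = 2 N W
  have hkey : P.spacing k ^ 2 * msq * N ^ 2 ≤ 2 * (N * W) := by
    have hA : P.spacing k ^ 2 * msq * N ^ 2 ≤ N * W + γ₀ / 2 * N ^ 2 := by
      rw [hNsq]; linarith
    have hB : γ₀ / 2 * N ^ 2 ≤ N * W := by
      have : γ₀ / 2 * N * N ≤ γ₀ / 2 * N * (2 / γ₀ * W) :=
        mul_le_mul_of_nonneg_left hNW (by positivity)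
      have e : γ₀ / 2 * N * (2 / γ₀ * W) = N * W := by field_simp
      nlinarith
    linarith
  by_cases hN00 : N = 0
  · rw [hN00, mul_zero]; positivity
  · have hNp : 0 < N := lt_of_le_of_ne hN0 (Ne.symm hN00)
    have : P.spacing k ^ 2 * msq * N * N ≤ 2 * W * N := by nlinarith
    exact le_of_mul_le_mul_right this hNp

/-- **product rule for the forward derivative with a weight**: `∂(w·f)(x) = w(x+ηe_μ)·∂f(x) + η⁻¹(w(x+ηe_μ) − w(x))·f(x)`.
[cite: Balaban1984PropagatorsI, p.36 («e^{−⟨q,x⟩}Δ_a e^{⟨q,x⟩} − Δ_a … small perturbation of Δ_a»)] -/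
theorem deriv_pmul (s : ℝ) (μ : Fin P.d) (w f : Site P 0 → ℝ) (x : Site P 0) :
    (deriv P 0 s μ *ᵥ pmul w f) x
      = w (Site.shift x μ) * (deriv P 0 s μ *ᵥ f) x + s⁻¹ * (w (Site.shift x μ) - w x) * f x := by
  simp only [deriv_mulVec, pmul_apply]; ring

/-- the weight along one fine step: `w(x+ηe_μ) ≤ (3/2)·w(x)` and `|η⁻¹(w(x+ηe_μ) − w(x))| ≤ 2δ·w(x)` (ρ Lipschitz,
0 ≤ δ, 4δ ≤ 1). [cite: Balaban1984PropagatorsI, p.36 («e^{−⟨q,x⟩}Δ_a e^{⟨q,x⟩} − Δ_a … small perturbation of Δ_a»)] -/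
theorem wt_step_bounds {ρ : Site P 0 → ℝ} (hρ : LipX P k ρ) {δ : ℝ} (hδ0 : 0 ≤ δ) (hδ4 : 4 * δ ≤ 1)
    (x : Site P 0) (μ : Fin P.d) :
    wt P δ ρ (Site.shift x μ) ≤ 3 / 2 * wt P δ ρ x ∧
      |(((P.L : ℝ) ^ k)⁻¹)⁻¹ * (wt P δ ρ (Site.shift x μ) - wt P δ ρ x)| ≤ 2 * δ * wt P δ ρ x := by
  obtain ⟨hσ, hδη⟩ := abs_delta_step_le hρ hδ0 (by linarith) x μ
  set σ := δ * (ρ (Site.shift x μ) - ρ x) with hσdef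
  have hw0 := wt_pos (P := P) δ ρ x
  have hratio : wt P δ ρ (Site.shift x μ) = wt P δ ρ x * Real.exp σ := by
    have := wt_div δ ρ x (Site.shift x μ)
    rw [← this, mul_div_cancel₀ _ hw0.ne']
  have hσ1 : |σ| ≤ 1 := hσ.trans hδη
  have he : |Real.exp σ - 1| ≤ 2 * |σ| := Real.abs_exp_sub_one_le hσ1
  have hη := eta_pos (P := P) k
  refine ⟨?_, ?_⟩
  · rw [hratio]
    have : Real.exp σ ≤ 3 / 2 := by
      have h1 := (abs_le.mp he).2
      have h2 : |σ| ≤ δ * ((P.L : ℝ) ^ k)⁻¹ := hσ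
      have h3 : δ * ((P.L : ℝ) ^ k)⁻¹ ≤ δ := by
        have := mul_le_mul_of_nonneg_left (eta_le_one (P := P) k) hδ0; rwa [mul_one] at this
      linarith
    nlinarith
  · rw [hratio, show wt P δ ρ x * Real.exp σ - wt P δ ρ x = wt P δ ρ x * (Real.exp σ - 1) by ring, abs_mul,
      abs_mul, abs_of_pos hw0, abs_of_pos (inv_pos.mpr hη), inv_inv]
    have hLk : ((P.L : ℝ) ^ k) ≠ 0 := (pow_pos P.cast_L_pos k).ne'
    have h2 : (P.L : ℝ) ^ k * |Real.exp σ - 1| ≤ 2 * δ := by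
      calc (P.L : ℝ) ^ k * |Real.exp σ - 1| ≤ (P.L : ℝ) ^ k * (2 * (δ * ((P.L : ℝ) ^ k)⁻¹)) :=
            mul_le_mul_of_nonneg_left (he.trans (by linarith)) (pow_pos P.cast_L_pos k).le
        _ = 2 * δ := by field_simp
    calc (P.L : ℝ) ^ k * (wt P δ ρ x * |Real.exp σ - 1|) = wt P δ ρ x * ((P.L : ℝ) ^ k * |Real.exp σ - 1|) := by
          ring
      _ ≤ wt P δ ρ x * (2 * δ) := mul_le_mul_of_nonneg_left h2 hw0.le
      _ = 2 * δ * wt P δ ρ x := by ring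

/-- pointwise size of `∂(w·u)`: `|∂_μ(wu)(x)| ≤ w(x)·((3/2)|∂_μu(x)| + 2δ|u(x)|)`. [cite: Balaban1984PropagatorsI, p.36 («e^{−⟨q,x⟩}Δ_a e^{⟨q,x⟩} − Δ_a … small perturbation of Δ_a»)] -/
theorem abs_deriv_pmul_le {ρ : Site P 0 → ℝ} (hρ : LipX P k ρ) {δ : ℝ} (hδ0 : 0 ≤ δ) (hδ4 : 4 * δ ≤ 1)
    (μ : Fin P.d) (u : Site P 0 → ℝ) (x : Site P 0) :
    |(deriv P 0 ((P.L : ℝ) ^ k)⁻¹ μ *ᵥ pmul (wt P δ ρ) u) x|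
      ≤ wt P δ ρ x * (3 / 2 * |(deriv P 0 ((P.L : ℝ) ^ k)⁻¹ μ *ᵥ u) x| + 2 * δ * |u x|) := by
  rw [deriv_pmul]
  obtain ⟨h1, h2⟩ := wt_step_bounds hρ hδ0 hδ4 x μ
  have hw0 := wt_pos (P := P) δ ρ x
  have hws := (wt_pos (P := P) δ ρ (Site.shift x μ)).le
  calc |wt P δ ρ (Site.shift x μ) * (deriv P 0 ((P.L : ℝ) ^ k)⁻¹ μ *ᵥ u) x +
          (((P.L : ℝ) ^ k)⁻¹)⁻¹ * (wt P δ ρ (Site.shift x μ) - wt P δ ρ x) * u x|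
      ≤ |wt P δ ρ (Site.shift x μ) * (deriv P 0 ((P.L : ℝ) ^ k)⁻¹ μ *ᵥ u) x| +
          |(((P.L : ℝ) ^ k)⁻¹)⁻¹ * (wt P δ ρ (Site.shift x μ) - wt P δ ρ x) * u x| := abs_add_le _ _
    _ = wt P δ ρ (Site.shift x μ) * |(deriv P 0 ((P.L : ℝ) ^ k)⁻¹ μ *ᵥ u) x| +
          |(((P.L : ℝ) ^ k)⁻¹)⁻¹ * (wt P δ ρ (Site.shift x μ) - wt P δ ρ x)| * |u x| := by
        rw [abs_mul, abs_mul, abs_of_nonneg hws]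
    _ ≤ 3 / 2 * wt P δ ρ x * |(deriv P 0 ((P.L : ℝ) ^ k)⁻¹ μ *ᵥ u) x| + 2 * δ * wt P δ ρ x * |u x| :=
        add_le_add (mul_le_mul_of_nonneg_right h1 (abs_nonneg _)) (mul_le_mul_of_nonneg_right h2 (abs_nonneg _))
    _ = wt P δ ρ x * (3 / 2 * |(deriv P 0 ((P.L : ℝ) ^ k)⁻¹ μ *ᵥ u) x| + 2 * δ * |u x|) := by ring

/-- `√(Σ u²) ≤ √(dirE + nsq)` and `√(Σ(∂_μu)²) ≤ √(dirE + nsq)`. [cite: Balaban1984PropagatorsI, Prop. 1.1 (1.89)–(1.90) p.33] -/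
theorem sqrt_parts_le (k : ℕ) (μ : Fin P.d) (u : Site P 0 → ℝ) :
    Real.sqrt (nsq P u) ≤ Real.sqrt (dirE P k u + nsq P u) ∧
      Real.sqrt (nsq P (deriv P 0 ((P.L : ℝ) ^ k)⁻¹ μ *ᵥ u)) ≤ Real.sqrt (dirE P k u + nsq P u) := by
  refine ⟨Real.sqrt_le_sqrt (by linarith [dirE_nonneg k u]), Real.sqrt_le_sqrt ?_⟩
  have := sum_sq_deriv_le_dirE k μ u
  have h0 := nsq_nonneg (P := P) u
  unfold nsq at h0 ⊢
  linarith

/-- **THE WEIGHTED SOLVE WITH A DIVERGENCE SOURCE**: under (1.90) and `(2d + 16a)δ² ≤ γ₀/2`, for every g, with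
v = G₀∂*_νg (∂*_ν = the transpose) and u = e^{δρ}v: `Σ_μ‖∂_μu‖² + ‖u‖² ≤ (4/γ₀)²·‖e^{δρ}g‖²` — the L² form of
«‖G∇*J‖, ‖∇G∇*J‖ ≤ γ₀⁻¹‖J‖» surviving the conjugation. [cite: Balaban1984PropagatorsI, p.36, (1.89)–(1.90) p.33] -/
theorem solveT_bound {ρ : Site P 0 → ℝ} (hρ : LipX P k ρ) (hk : k ≤ P.m + P.K) {a msq : ℝ} (ha : 0 < a)
    (hm : 0 ≤ msq) (μ : Fin P.d) {γ₀ : ℝ} (hγ : 0 < γ₀)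
    (hco : ∀ f : Site P 0 → ℝ, γ₀ * (f ⬝ᵥ ((lapEta P k + 1) *ᵥ f)) ≤ f ⬝ᵥ (M0 P a msq k μ *ᵥ f))
    {δ : ℝ} (hδ0 : 0 ≤ δ) (hδ4 : 4 * δ ≤ 1) (hδγ : (2 * P.d + 16 * a) * δ ^ 2 ≤ γ₀ / 2)
    (ν : Fin P.d) (g : Site P 0 → ℝ) :
    dirE P k (pmul (wt P δ ρ) (G0 P a msq k μ *ᵥ ((deriv P 0 ((P.L : ℝ) ^ k)⁻¹ ν)ᵀ *ᵥ g)))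
        + nsq P (pmul (wt P δ ρ) (G0 P a msq k μ *ᵥ ((deriv P 0 ((P.L : ℝ) ^ k)⁻¹ ν)ᵀ *ᵥ g)))
      ≤ (4 / γ₀) ^ 2 * nsq P (pmul (wt P δ ρ) g) := by
  set w := wt P δ ρ with hw
  set D := deriv P 0 ((P.L : ℝ) ^ k)⁻¹ ν with hD
  set v := G0 P a msq k μ *ᵥ (Dᵀ *ᵥ g) with hv
  set u := pmul w v with hu
  have hMv : M0 P a msq k μ *ᵥ v = Dᵀ *ᵥ g := by
    rw [hv, Matrix.mulVec_mulVec, M0_mul_G0 ha hm hk, Matrix.one_mulVec]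
  have hform : pmul w u ⬝ᵥ (M0 P a msq k μ *ᵥ pmul (fun z => (w z)⁻¹) u) = (D *ᵥ pmul w u) ⬝ᵥ g := by
    rw [hu, pmul_inv_pmul w v (wt_ne_zero δ ρ), hMv, Matrix.dotProduct_mulVec, Matrix.vecMul_transpose]
  have hconj := conjM0_ge hρ hk ha.le hδ0 hδ4 msq μ u
  have hcoe := hco u
  rw [form_lapEta_add_one] at hcoe
  have hX2 : 0 ≤ dirE P k u + nsq P u := add_nonneg (dirE_nonneg k u) (nsq_nonneg u)
  set X := Real.sqrt (dirE P k u + nsq P u) with hX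
  set W := Real.sqrt (nsq P (pmul w g)) with hW
  have hXsq : X ^ 2 = dirE P k u + nsq P u := Real.sq_sqrt hX2
  have hWsq : W ^ 2 = nsq P (pmul w g) := Real.sq_sqrt (nsq_nonneg _)
  have hW0 : 0 ≤ W := Real.sqrt_nonneg _
  have hX0 : 0 ≤ X := Real.sqrt_nonneg _
  -- |(∂(wu))·g| ≤ 2 W X
  have hsrc : (D *ᵥ pmul w u) ⬝ᵥ g ≤ 2 * (X * W) := by
    have hpt : ∀ x, (D *ᵥ pmul w u) x * g x
        ≤ 3 / 2 * (|(D *ᵥ u) x| * |pmul w g x|) + 1 / 2 * (|u x| * |pmul w g x|) := by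
      intro x
      have hb := abs_deriv_pmul_le hρ hδ0 hδ4 ν u x
      rw [← hD] at hb
      have h1 : (D *ᵥ pmul w u) x * g x ≤ |(D *ᵥ pmul w u) x| * |g x| := by
        rw [← abs_mul]; exact le_abs_self _
      have hwg : |pmul w g x| = w x * |g x| := by
        rw [pmul_apply, abs_mul, abs_of_pos (wt_pos δ ρ x)]
      rw [hwg]
      have hg0 := abs_nonneg (g x)
      have hw0 := (wt_pos (P := P) δ ρ x).le
      have h2δ : 2 * δ ≤ 1 / 2 := by linarith
      have h2 := mul_le_mul_of_nonneg_right hb hg0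
      have h3 : 2 * δ * |u x| ≤ 1 / 2 * |u x| := mul_le_mul_of_nonneg_right h2δ (abs_nonneg _)
      nlinarith [abs_nonneg ((D *ᵥ u) x), abs_nonneg (u x), mul_nonneg hw0 hg0]
    have hs1 := sum_abs_mul_abs_le_sqrt_nsq (D *ᵥ u) (pmul w g)
    have hs2 := sum_abs_mul_abs_le_sqrt_nsq u (pmul w g)
    obtain ⟨hp1, hp2⟩ := sqrt_parts_le k ν u
    rw [← hD] at hp2
    calc (D *ᵥ pmul w u) ⬝ᵥ g = ∑ x, (D *ᵥ pmul w u) x * g x := rfl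
      _ ≤ ∑ x, (3 / 2 * (|(D *ᵥ u) x| * |pmul w g x|) + 1 / 2 * (|u x| * |pmul w g x|)) := sum_le_sum fun x _ => hpt x
      _ = 3 / 2 * ∑ x, |(D *ᵥ u) x| * |pmul w g x| + 1 / 2 * ∑ x, |u x| * |pmul w g x| := by
          rw [sum_add_distrib, mul_sum, mul_sum]
      _ ≤ 3 / 2 * (X * W) + 1 / 2 * (X * W) := by
          have e1 := hs1.trans (mul_le_mul_of_nonneg_right hp2 hW0)
          have e2 := hs2.trans (mul_le_mul_of_nonneg_right hp1 hW0)
          linarith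
      _ = 2 * (X * W) := by ring
  have hmain : γ₀ / 2 * X ^ 2 ≤ X * (2 * W) := by
    rw [hXsq]
    have hδn : (2 * P.d + 16 * a) * δ ^ 2 * nsq P u ≤ γ₀ / 2 * nsq P u :=
      mul_le_mul_of_nonneg_right hδγ (nsq_nonneg u)
    calc γ₀ / 2 * (dirE P k u + nsq P u)
        ≤ u ⬝ᵥ (M0 P a msq k μ *ᵥ u) - (2 * P.d + 16 * a) * δ ^ 2 * nsq P u := by
          nlinarith [dirE_nonneg k u]
      _ ≤ (D *ᵥ pmul w u) ⬝ᵥ g := by rw [← hform]; exact hconj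
      _ ≤ X * (2 * W) := by linarith
  have := sq_le_of_quad hγ hX0 (by positivity) hmain
  rw [hXsq] at this
  calc _ ≤ (2 / γ₀) ^ 2 * (2 * W) ^ 2 := this
    _ = (4 / γ₀) ^ 2 * W ^ 2 := by ring
    _ = (4 / γ₀) ^ 2 * nsq P (pmul w g) := by rw [hWsq]

end Solve

end B5CombesThomasTorus

end

end Literature.MathematicalPhysics.QuantumFieldTheory.Balaban1983to89
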